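import Summits.AtomisticToContinuum.HydrodynamicLimit.Theorems.OneSphereInfluenceHardCorePoincareDobrushinBounds

/-!
# OneSphereInfluenceHardCorePoincareDobrushinDoor — DLR identity, the typed pieces [K] [G], the
kernel and [G] proved

This file is part 3/9 of the DobrushinDoor chain proving the crux
`OneSphereInfluence.HardCorePoincare` (stmt-AtomisticToContinuum-13619) sorry-free; the closing
theorem `hardCorePoincare_holds` and the full account are in
`OneSphereInfluenceHardCorePoincareDobrushin.lean` (part 9/9). decomp-a2c · lens-1 · g39.

CONTENTS. The DLR (heat-bath) identity `lintegral_siteKernel_update` (site-wise invariance of the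
canonical hard-sphere Gibbs measure, by disintegration along `MeasurableEquiv.piFinSuccAbove`); the
two typed pieces [K] `DobrushinGlauberPoincare`, [G] `HeatBathDobrushin`; the kernel
`hardCorePoincare_of_dobrushin : [K] → [G] → HardCorePoincare`; the constants `dobrushin_constants`;
`heatBathDobrushin_holds : [G]`; and `hardCorePoincare_of_dobrushinGlauberPoincare : [K] →
HardCorePoincare`.
-/

open MeasureTheory ProbabilityTheory Set
open scoped ENNReal

noncomputable section

namespace Summit.AtomisticToContinuum.HydrodynamicLimit.Theorems.HardCorePoincareDobrushin

open Literature.MathematicalPhysics.KineticTheory Literature.Analysis.FluidPDE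

/-! ## Chunk C — the DLR (heat-bath) identity -/

section DLR

variable {N : ℕ}

/-- Splitting the hard-sphere constraint at particle `i`. -/
theorem mem_hardSphereDomain_succ_iff (ε : ℝ) (i : Fin (N + 1)) (z : Config (N + 1) (Fin 3) T3) :
    z ∈ hardSphereDomain (Torus.geometry (Fin 3)) (N + 1) ε ↔
      z i ∈ freeSet ε (i.removeNth z) ∧
        i.removeNth z ∈ hardSphereDomain (Torus.geometry (Fin 3)) N ε := by
  simp only [mem_hardSphereDomain, Torus.norm_geometry_sepVec, freeSet, posFree, mem_preimage,
    mem_setOf_eq, Fin.removeNth]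
  constructor
  · intro h
    refine ⟨fun k => h i (i.succAbove k) (Fin.ne_succAbove i k), fun k l hkl => h _ _ ?_⟩
    exact fun hh => hkl (Fin.succAbove_right_injective hh)
  · rintro ⟨h1, h2⟩ p q hpq
    by_cases hp : p = i
    · have hq : q ≠ i := fun hq => hpq (hp.trans hq.symm)
      obtain ⟨l, hl⟩ := Fin.exists_succAbove_eq hq
      rw [hp, ← hl]
      exact h1 l
    · obtain ⟨k, hk⟩ := Fin.exists_succAbove_eq hp
      by_cases hq : q = i
      · rw [hq, ← hk, Torus.euclidDist_comm]
        exact h1 k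
      · obtain ⟨l, hl⟩ := Fin.exists_succAbove_eq hq
        rw [← hk, ← hl]
        refine h2 k l fun hkl => hpq ?_
        rw [← hk, ← hl, hkl]

/-- Splitting the tensor power at particle `i`. -/
theorem tensorPow_succ_eq (φ : T3 × V3 → ℝ) (i : Fin (N + 1)) (z : Config (N + 1) (Fin 3) T3) :
    tensorPow (N + 1) φ z = φ (z i) * tensorPow N φ (i.removeNth z) := by
  simp only [tensorPow, Fin.removeNth]
  exact Fin.prod_univ_succAbove (fun j => φ (z j)) i

/-- Unfolding lemma: the inverse of `MeasurableEquiv.piFinSuccAbove` at `i` is `Fin.insertNth i`. -/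
theorem piFinSuccAbove_symm_apply' (i : Fin (N + 1)) (x : T3 × V3) (ω : Config N (Fin 3) T3) :
    (MeasurableEquiv.piFinSuccAbove (fun _ : Fin (N + 1) => T3 × V3) i).symm (x, ω) =
      Fin.insertNth i x ω := rfl

/-- **DLR identity**: the one-site heat-bath kernel of site `i` leaves the canonical hard-sphere
measure with one-particle profile `φ` invariant (resampling particle `i` from its conditional
law). -/
theorem lintegral_siteKernel_update {φ : T3 × V3 → ℝ} (hφm : Measurable φ) (hφ0 : ∀ y, 0 ≤ φ y)
    (ε : ℝ) (h0 : ∀ ω : Config N (Fin 3) T3, siteNorm φ ε ω ≠ 0)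
    (htop : ∀ ω : Config N (Fin 3) T3, siteNorm φ ε ω ≠ ⊤) (i : Fin (N + 1))
    {f : Config (N + 1) (Fin 3) T3 → ℝ≥0∞} (hf : Measurable f) :
    ∫⁻ z, ∫⁻ y, f (Function.update z i y) ∂(siteKernel hφm ε i z)
        ∂(volume.withDensity fun z => ENNReal.ofReal
          (canonicalDensity (Torus.geometry (Fin 3)) ε (N + 1) φ z)) =
      ∫⁻ z, f z ∂(volume.withDensity fun z => ENNReal.ofReal
          (canonicalDensity (Torus.geometry (Fin 3)) ε (N + 1) φ z)) := by
  haveI : IsMarkovKernel (siteKernel hφm ε i) := isMarkovKernel_siteKernel hφm ε i h0 htop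
  -- measurability
  have hρm : Measurable fun z : Config (N + 1) (Fin 3) T3 => ENNReal.ofReal
      (canonicalDensity (Torus.geometry (Fin 3)) ε (N + 1) φ z) :=
    (measurable_canonicalDensity ε (N + 1) hφm).ennreal_ofReal
  have hg : ∀ z : Config (N + 1) (Fin 3) T3, Measurable fun y => f (Function.update z i y) :=
    fun z => hf.comp (measurable_update z)
  have hGL : Measurable fun z : Config (N + 1) (Fin 3) T3 =>
      ∫⁻ y, f (Function.update z i y) ∂(siteKernel hφm ε i z) := by
    have h1 : Measurable (Function.uncurry fun (z : Config (N + 1) (Fin 3) T3) (y : T3 × V3) =>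
        f (Function.update z i y)) := hf.comp (measurable_update' (a := i))
    exact h1.lintegral_kernel_prod_right
  rw [lintegral_withDensity_eq_lintegral_mul _ hρm hGL, lintegral_withDensity_eq_lintegral_mul _ hρm hf]
  simp only [Pi.mul_apply]
  -- transport along `z ↦ (z i, z_{-i})`
  set e := MeasurableEquiv.piFinSuccAbove (fun _ : Fin (N + 1) => T3 × V3) i with he
  have hSF : SigmaFinite (volume : Measure (T3 × V3)) := inferInstance
  have hmp0 : MeasurePreserving e (volume : Measure (Config (N + 1) (Fin 3) T3))
      ((volume : Measure (T3 × V3)).prod (volume : Measure (Config N (Fin 3) T3))) :=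
    @measurePreserving_piFinSuccAbove N (fun _ => T3 × V3) _ (fun _ => volume) (fun _ => hSF) i
  have hmp := hmp0.symm e
  have hFL : Measurable fun z : Config (N + 1) (Fin 3) T3 =>
      ENNReal.ofReal (canonicalDensity (Torus.geometry (Fin 3)) ε (N + 1) φ z) *
        ∫⁻ y, f (Function.update z i y) ∂(siteKernel hφm ε i z) := hρm.mul hGL
  have hFR : Measurable fun z : Config (N + 1) (Fin 3) T3 =>
      ENNReal.ofReal (canonicalDensity (Torus.geometry (Fin 3)) ε (N + 1) φ z) * f z := hρm.mul hf
  rw [← hmp.lintegral_comp hFL, ← hmp.lintegral_comp hFR]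
  rw [lintegral_prod_symm (fun p : (T3 × V3) × Config N (Fin 3) T3 =>
      ENNReal.ofReal (canonicalDensity (Torus.geometry (Fin 3)) ε (N + 1) φ (e.symm p)) *
        ∫⁻ y, f (Function.update (e.symm p) i y) ∂(siteKernel hφm ε i (e.symm p)))
      (hFL.comp e.symm.measurable).aemeasurable,
    lintegral_prod_symm (fun p : (T3 × V3) × Config N (Fin 3) T3 =>
      ENNReal.ofReal (canonicalDensity (Torus.geometry (Fin 3)) ε (N + 1) φ (e.symm p)) * f (e.symm p))
      (hFR.comp e.symm.measurable).aemeasurable]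
  refine lintegral_congr fun ω => ?_
  -- pointwise identities at `z = insertNth i x ω`
  have hF1 : ∀ x : T3 × V3, i.removeNth (e.symm (x, ω)) = ω := fun x => by
    rw [piFinSuccAbove_symm_apply', Fin.removeNth_insertNth]
  have hF2 : ∀ x : T3 × V3, e.symm (x, ω) i = x := fun x => by
    rw [piFinSuccAbove_symm_apply', Fin.insertNth_apply_same]
  have hF3 : ∀ x y : T3 × V3, Function.update (e.symm (x, ω)) i y = e.symm (y, ω) := fun x y => by
    rw [piFinSuccAbove_symm_apply', piFinSuccAbove_symm_apply', Fin.update_insertNth]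
  -- abbreviations
  have hZ0 : 0 ≤ (canonicalPartition (Torus.geometry (Fin 3)) ε (N + 1) φ)⁻¹ :=
    inv_nonneg.2 (canonicalPartition_nonneg _ ε (N + 1) fun y => hφ0 y)
  set C : ℝ≥0∞ := ENNReal.ofReal (canonicalPartition (Torus.geometry (Fin 3)) ε (N + 1) φ)⁻¹ with hC
  set R : ℝ≥0∞ := ENNReal.ofReal ((hardSphereDomain (Torus.geometry (Fin 3)) N ε).indicator
    (tensorPow N φ) ω) with hR
  set W : T3 × V3 → ℝ≥0∞ := siteWeight φ ε ω with hW
  set n : ℝ≥0∞ := siteNorm φ ε ω with hn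
  have hWm : Measurable W := measurable_siteWeight hφm ε ω
  -- density factorisation
  have hρ : ∀ x : T3 × V3, ENNReal.ofReal
      (canonicalDensity (Torus.geometry (Fin 3)) ε (N + 1) φ (e.symm (x, ω))) = C * (W x * R) := by
    intro x
    by_cases hz : e.symm (x, ω) ∈ hardSphereDomain (Torus.geometry (Fin 3)) (N + 1) ε
    · have hz' := (mem_hardSphereDomain_succ_iff ε i _).1 hz
      rw [hF1, hF2] at hz'
      rw [canonicalDensity, indicator_of_mem hz, tensorPow_succ_eq φ i, hF1, hF2,
        ENNReal.ofReal_mul hZ0, ENNReal.ofReal_mul (hφ0 x), hW, siteWeight, indicator_of_mem hz'.1,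
        hR, indicator_of_mem hz'.2]
    · have hz' : ¬ (x ∈ freeSet ε ω ∧ ω ∈ hardSphereDomain (Torus.geometry (Fin 3)) N ε) := by
        intro hh
        apply hz
        rw [mem_hardSphereDomain_succ_iff ε i, hF1, hF2]
        exact hh
      rw [canonicalDensity, indicator_of_notMem hz, mul_zero, ENNReal.ofReal_zero]
      rcases not_and_or.1 hz' with hx | hω
      · rw [hW, siteWeight, indicator_of_notMem hx, zero_mul, mul_zero]
      · rw [hR, indicator_of_notMem hω, ENNReal.ofReal_zero, mul_zero, mul_zero]
  -- the kernel integral at `z = insertNth i x ω`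
  have hK : ∀ x : T3 × V3, ∫⁻ y, f (Function.update (e.symm (x, ω)) i y)
      ∂(siteKernel hφm ε i (e.symm (x, ω))) = n⁻¹ * ∫⁻ y, W y * f (e.symm (y, ω)) := by
    intro x
    rw [lintegral_siteKernel hφm ε i _ (hg _), hF1]
    simp_rw [hF3 x]
    rfl
  have hJm : Measurable fun y : T3 × V3 => W y * f (e.symm (y, ω)) := by
    have h1 : Measurable fun y : T3 × V3 => e.symm (y, ω) :=
      e.symm.measurable.comp measurable_prodMk_right
    have h2 := hf.comp h1
    exact hWm.mul h2
  simp_rw [hρ, hK]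
  -- left: ∫ x, C * (W x * R) * (n⁻¹ * J) = n * (C * R * n⁻¹ * J) = C * R * J ; right: C * R * J
  have hl : ∀ x : T3 × V3, C * (W x * R) * (n⁻¹ * ∫⁻ y, W y * f (e.symm (y, ω))) =
      W x * (C * R * n⁻¹ * ∫⁻ y, W y * f (e.symm (y, ω))) := fun x => by ring
  have hr : ∀ x : T3 × V3, C * (W x * R) * f (e.symm (x, ω)) =
      (C * R) * (W x * f (e.symm (x, ω))) := fun x => by ring
  simp_rw [hl, hr]
  rw [lintegral_mul_const _ hWm, lintegral_const_mul _ hJm]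
  calc n * (C * R * n⁻¹ * ∫⁻ y, W y * f (e.symm (y, ω)))
      = C * R * (∫⁻ y, W y * f (e.symm (y, ω))) * (n * n⁻¹) := by ring
    _ = C * R * ∫⁻ y, W y * f (e.symm (y, ω)) := by
        rw [ENNReal.mul_inv_cancel (h0 ω) (htop ω), mul_one]

end DLR

/-! ## The two typed pieces [K], [G] and the kernel `[K] → [G] → HardCorePoincare` -/

section Door

/-- [K] KNOWN · COSTUME(cite) — **Dobrushin–Glauber Poincaré inequality** (dependent tensorisation
of variance under Dobrushin's uniqueness condition), abstract form over a finite product of an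
arbitrary measurable single-site space `E`: local, `μ`-invariant one-site Markov kernels `K i` with
total-variation interdependence coefficients `c i j` whose row and column sums are `≤ D < 1` give
`Var_μ f ≤ (1 − D)⁻¹ Σ_i ∫ condVar(σ(z_{−i})) f dμ`. Sources: Wu (2006) Ann. Probab. 34, Thm 2.2
(doi:10.1214/009117906000000368); Ollivier (2009) JFA 256, Ex. 12 + Prop. 30 (arXiv:math/0701886);
elementary proof in the module docstring §0.4. No model content. -/
def DobrushinGlauberPoincare : Prop :=
  ∀ (n : ℕ) (E : Type) [MeasurableSpace E]
    (μ : Measure (Fin (n + 1) → E)) [IsProbabilityMeasure μ]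
    (K : Fin (n + 1) → Kernel (Fin (n + 1) → E) E) [∀ i, IsMarkovKernel (K i)]
    (c : Fin (n + 1) → Fin (n + 1) → ℝ) (D : ℝ),
    (∀ i (z : Fin (n + 1) → E) (y : E), K i (Function.update z i y) = K i z) →
    (∀ i (f : (Fin (n + 1) → E) → ℝ≥0∞), Measurable f →
        ∫⁻ z, ∫⁻ y, f (Function.update z i y) ∂(K i z) ∂μ = ∫⁻ z, f z ∂μ) →
    (∀ i j, 0 ≤ c i j) →
    (∀ i j (z : Fin (n + 1) → E) (y : E) (A : Set E), MeasurableSet A →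
        ((K i z) A).toReal ≤ ((K i (Function.update z j y)) A).toReal + c i j) →
    (∀ i, ∑ j, c i j ≤ D) → (∀ j, ∑ i, c i j ≤ D) → D < 1 →
    ∀ f : (Fin (n + 1) → E) → ℝ, MemLp f 2 μ →
      variance f μ ≤ (1 - D)⁻¹ * ∑ i : Fin (n + 1), ∫ z, condVar
        (MeasurableSpace.comap (fun (z : Fin (n + 1) → E) (j : Fin n) => z (i.succAbove j))
          MeasurableSpace.pi) f μ z ∂μ

/-- [G] **Heat-bath one-site specification of the hard-sphere local Gibbs measure satisfies
Dobrushin's condition uniformly in `N` at small packing.** -/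
def HeatBathDobrushin : Prop :=
  ∀ (a₁ θ₁ : T3 → ℝ) (u₁ : T3 → V3), Continuous a₁ → Continuous θ₁ → Continuous u₁ →
    (∀ x, 0 < a₁ x) → (∀ x, 0 < θ₁ x) →
    ∃ σ₀ : ℝ, 0 < σ₀ ∧ σ₀ ≤ 1 / 2 ∧ ∀ σ : ℝ, 0 < σ → σ < σ₀ → ∃ D : ℝ, D < 1 ∧ ∀ N : ℕ,
      ∃ (K : Fin (N + 1) → Kernel (Config (N + 1) (Fin 3) T3) (T3 × V3))
        (_ : ∀ i, IsMarkovKernel (K i)) (c : Fin (N + 1) → Fin (N + 1) → ℝ),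
        (∀ i (z : Config (N + 1) (Fin 3) T3) (y : T3 × V3), K i (Function.update z i y) = K i z) ∧
        (∀ i (f : Config (N + 1) (Fin 3) T3 → ℝ≥0∞), Measurable f →
          ∫⁻ z, ∫⁻ y, f (Function.update z i y) ∂(K i z) ∂(localGibbsMeasure σ a₁ u₁ θ₁ N) =
            ∫⁻ z, f z ∂(localGibbsMeasure σ a₁ u₁ θ₁ N)) ∧
        (∀ i j, 0 ≤ c i j) ∧
        (∀ i j (z : Config (N + 1) (Fin 3) T3) (y : T3 × V3) (A : Set (T3 × V3)),
          MeasurableSet A →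
          ((K i z) A).toReal ≤ ((K i (Function.update z j y)) A).toReal + c i j) ∧
        (∀ i, ∑ j, c i j ≤ D) ∧ (∀ j, ∑ i, c i j ≤ D)

/-- KERNEL: `[K] → [G] → HardCorePoincare` (13619, BY NAME). -/
theorem hardCorePoincare_of_dobrushin (hK : DobrushinGlauberPoincare) (hG : HeatBathDobrushin) :
    Theses.OneSphereInfluence.HardCorePoincare := by
  intro a₁ θ₁ u₁ ha hθ hu ha0 hθ0
  obtain ⟨σ₀, hσ₀, hσ₀h, hσ⟩ := hG a₁ θ₁ u₁ ha hθ hu ha0 hθ0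
  refine ⟨σ₀, hσ₀, fun σ hs hsσ => ?_⟩
  obtain ⟨D, hD1, hN⟩ := hσ σ hs hsσ
  refine ⟨max 1 (1 - D)⁻¹, lt_max_of_lt_left one_pos, fun N Φ F hF => ?_⟩
  obtain ⟨K, hKm, c, hloc, hinv, hc0, hTV, hrow, hcol⟩ := hN N
  have hσ2 : σ ≤ 1 / 2 := by linarith
  simp only [localGibbsLaw_eq] at hF ⊢
  haveI := isProbabilityMeasure_localGibbsMeasure (u₀ := u₁) ha hθ hu ha0 hθ0 hσ2 N
  haveI := hKm
  have key := hK N (T3 × V3) (localGibbsMeasure σ a₁ u₁ θ₁ N) K c D hloc hinv hc0 hTV hrow hcol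
    hD1 F hF
  have hS : 0 ≤ ∑ i : Fin (N + 1), ∫ z, condVar
      (MeasurableSpace.comap (fun (z : Config (N + 1) (Fin 3) T3) (j : Fin N) => z (i.succAbove j))
        MeasurableSpace.pi) F (localGibbsMeasure σ a₁ u₁ θ₁ N) z ∂(localGibbsMeasure σ a₁ u₁ θ₁ N) :=
    Finset.sum_nonneg fun i _ => integral_nonneg_of_ae
      (condExp_nonneg (ae_of_all _ fun ω => sq_nonneg _))
  exact key.trans (mul_le_mul_of_nonneg_right (le_max_right _ _) hS)

end Door

/-! ## Assembly — constants, `HeatBathDobrushin`, and the conditional closing of `HardCorePoincare` -/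

section Assembly

/-- `ε_N ^ 3 = σ ^ 3 / (N + 1)` for the Boltzmann–Grad diameter `ε_N = σ (N+1)^{-1/3}`. -/
theorem hsDiameter_pow_three (σ : ℝ) (N : ℕ) : hsDiameter σ N ^ 3 = σ ^ 3 / (N + 1) := by
  have hx : (0 : ℝ) ≤ ((N + 1 : ℕ) : ℝ) := Nat.cast_nonneg _
  rw [hsDiameter, mul_pow, ← Real.rpow_mul_natCast hx]
  norm_num [Real.rpow_neg_one, div_eq_mul_inv]

/-- The elementary inequality behind the choice `σ₀ = min (1/2) (I / (8A))`:
with `X = A σ³ (4π/3)` (the mass of one excluded ball at diameter `σ`), `I - X > 0` and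
`4X / (I - X) < 1`. -/
theorem dobrushin_constants {A I σ : ℝ} (hA : 0 < A) (hI : 0 < I) (hσ0 : 0 < σ) (hσ : σ < 1 / 2)
    (hσI : σ < I / (8 * A)) :
    0 < I - A * (σ ^ 3 * (Real.pi * 4 / 3)) ∧
      4 * (A * (σ ^ 3 * (Real.pi * 4 / 3))) / (I - A * (σ ^ 3 * (Real.pi * 4 / 3))) < 1 := by
  have hπ := Real.pi_le_four
  have hπ0 := Real.pi_pos.le
  have hσ3 : σ ^ 3 ≤ σ / 4 := by
    nlinarith [mul_nonneg (mul_nonneg hσ0.le hσ0.le) (sub_nonneg.2 hσ.le),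
      mul_nonneg hσ0.le (sub_nonneg.2 hσ.le)]
  have h8 : σ * (8 * A) < I := (lt_div_iff₀ (by positivity)).1 hσI
  have k1 : A * (σ ^ 3 * (Real.pi * 4 / 3)) ≤ A * ((σ / 4) * (16 / 3)) := by
    apply mul_le_mul_of_nonneg_left _ hA.le
    exact mul_le_mul hσ3 (by linarith) (by positivity) (by positivity)
  have k2 : A * ((σ / 4) * (16 / 3)) = (1 / 6) * (σ * (8 * A)) := by ring
  have hX0 : 0 ≤ A * (σ ^ 3 * (Real.pi * 4 / 3)) := by positivity
  constructor
  · linarith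
  · rw [div_lt_one (by linarith)]
    linarith

/-- **[G] PROVED.** The heat-bath one-site specification of the hard-sphere local Gibbs measure
(`siteKernel`) is local, leaves `localGibbsMeasure` invariant site by site (DLR consistency), and
satisfies Dobrushin's uniqueness condition with the constant interdependence matrix
`c i j = 4 A ε_N³ (4π/3) / (I - N A ε_N³ (4π/3))`, whose row and column sums are
`≤ D(σ) = 4 A σ³ (4π/3) / (I - A σ³ (4π/3)) < 1` for `σ < σ₀ = min (1/2) (I/(8A))`
(`A = sup a₁`, `I = ∫ a₁`), uniformly in `N`. -/
theorem heatBathDobrushin_holds : HeatBathDobrushin := by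
  intro a₁ θ₁ u₁ ha hθ hu ha0 hθ0
  obtain ⟨A, hA0', hA⟩ := exists_forall_abs_le_of_continuous ha
  have hAx : ∀ x, a₁ x ≤ A := fun x => (le_abs_self _).trans (hA x)
  have hApos : 0 < A := (ha0 0).trans_le (hAx 0)
  have ha0' : ∀ x, 0 ≤ a₁ x := fun x => (ha0 x).le
  set I := ∫ q, a₁ q with hI
  have hIpos : 0 < I := by
    rw [hI, integral_pos_iff_support_of_nonneg ha0' (integrable_of_continuous_T3 ha)]
    have : Function.support a₁ = univ := Set.eq_univ_of_forall fun x => (ha0 x).ne'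
    rw [this, measure_univ]
    exact zero_lt_one
  refine ⟨min (1 / 2) (I / (8 * A)), lt_min one_half_pos (div_pos hIpos (by positivity)),
    min_le_left _ _, ?_⟩
  intro σ hσ0 hσlt
  have hσ : σ < 1 / 2 := hσlt.trans_le (min_le_left _ _)
  have hσI : σ < I / (8 * A) := hσlt.trans_le (min_le_right _ _)
  obtain ⟨hℓ0, hD⟩ := dobrushin_constants hApos hIpos hσ0 hσ hσI
  refine ⟨4 * (A * (σ ^ 3 * (Real.pi * 4 / 3))) / (I - A * (σ ^ 3 * (Real.pi * 4 / 3))), hD, ?_⟩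
  intro N
  -- per-`N` data
  have hκ0 : (0 : ℝ) ≤ Real.pi * 4 / 3 := by positivity
  set κ := Real.pi * 4 / 3 with hκ
  set ε := hsDiameter σ N with hεdef
  -- (the tree's `Literature.MathematicalPhysics.KineticTheory.hsDiameter_pos` / `hsDiameter_le`, gate dedup)
  have hε0 : 0 < ε := hsDiameter_pos hσ0 N
  have hεσ : ε ≤ σ := hsDiameter_le hσ0.le N
  have hε : ε < 1 / 2 := hεσ.trans_lt hσ
  have hε3 : ε ^ 3 = σ ^ 3 / (N + 1) := hsDiameter_pow_three σ N
  have hm1 : ((N : ℝ) + 1) * (A * (ε ^ 3 * κ)) = A * (σ ^ 3 * κ) := by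
    rw [hε3]; field_simp
  have hm0 : 0 ≤ A * (ε ^ 3 * κ) := mul_nonneg hA0' (mul_nonneg (pow_nonneg hε0.le 3) hκ0)
  have hNε : (N : ℝ) * (A * (ε ^ 3 * κ)) ≤ A * (σ ^ 3 * κ) := by
    rw [← hm1]; nlinarith
  have hℓN : 0 < I - N * (A * (ε ^ 3 * κ)) := by linarith
  -- the one-particle profile
  have hφm : Measurable (localGibbsProfile a₁ u₁ θ₁) := measurable_localGibbsProfile ha hθ hu
  have hφ0 : ∀ y, 0 ≤ localGibbsProfile a₁ u₁ θ₁ y := localGibbsProfile_nonneg ha0' fun x => (hθ0 x).le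
  -- normalisations are uniformly bounded below (hence the kernels are Markov)
  have hlow : ∀ ω : Config N (Fin 3) T3,
      ENNReal.ofReal (I - N * (A * (ε ^ 3 * κ))) ≤ siteNorm (localGibbsProfile a₁ u₁ θ₁) ε ω :=
    fun ω => le_siteNorm ha hφm ha0' hθ0 hAx hA0' hε0.le hε ω
  have h0 : ∀ ω : Config N (Fin 3) T3, siteNorm (localGibbsProfile a₁ u₁ θ₁) ε ω ≠ 0 :=
    fun ω => ((ENNReal.ofReal_pos.2 hℓN).trans_le (hlow ω)).ne'
  have htop : ∀ ω : Config N (Fin 3) T3, siteNorm (localGibbsProfile a₁ u₁ θ₁) ε ω ≠ ⊤ :=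
    fun ω => siteNorm_ne_top ha hφm ha0' hθ0 ε ω
  -- the common value of the interdependence coefficients and its row sum
  have hc0 : 0 ≤ 2 * (2 * (A * (ε ^ 3 * κ)) / (I - N * (A * (ε ^ 3 * κ)))) :=
    mul_nonneg zero_le_two (div_nonneg (mul_nonneg zero_le_two hm0) hℓN.le)
  have hsum : ((N + 1 : ℕ) : ℝ) * (2 * (2 * (A * (ε ^ 3 * κ)) / (I - N * (A * (ε ^ 3 * κ))))) ≤
      4 * (A * (σ ^ 3 * κ)) / (I - A * (σ ^ 3 * κ)) := by
    have hℓN' : (I - N * (A * (ε ^ 3 * κ))) ≠ 0 := hℓN.ne'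
    calc ((N + 1 : ℕ) : ℝ) * (2 * (2 * (A * (ε ^ 3 * κ)) / (I - N * (A * (ε ^ 3 * κ)))))
        = 4 * (((N : ℝ) + 1) * (A * (ε ^ 3 * κ))) / (I - N * (A * (ε ^ 3 * κ))) := by
          push_cast; field_simp; ring
      _ = 4 * (A * (σ ^ 3 * κ)) / (I - N * (A * (ε ^ 3 * κ))) := by rw [hm1]
      _ ≤ 4 * (A * (σ ^ 3 * κ)) / (I - A * (σ ^ 3 * κ)) :=
          div_le_div_of_nonneg_left (by positivity) hℓ0 (by linarith)
  refine ⟨fun i => siteKernel hφm ε i, fun i => isMarkovKernel_siteKernel hφm ε i h0 htop,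
    fun _ _ => 2 * (2 * (A * (ε ^ 3 * κ)) / (I - N * (A * (ε ^ 3 * κ)))), ?_, ?_, ?_, ?_, ?_, ?_⟩
  · -- locality
    intro i z y
    exact siteKernel_update hφm ε i z y
  · -- DLR consistency (site-by-site invariance of the local Gibbs measure)
    intro i f hf
    exact lintegral_siteKernel_update hφm hφ0 ε h0 htop i hf
  · -- nonnegativity of the coefficients
    intro i j
    exact hc0
  · -- Dobrushin's total-variation bound
    intro i j z y S hS
    exact siteKernel_tv ha hφm ha0' hθ0 hAx hA0' hε0.le hε hℓN i j z y hS
  · -- row sums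
    intro i
    rw [Finset.sum_const, Finset.card_univ, Fintype.card_fin, nsmul_eq_mul]
    exact hsum
  · -- column sums
    intro j
    rw [Finset.sum_const, Finset.card_univ, Fintype.card_fin, nsmul_eq_mul]
    exact hsum

/-- **THE NODE THEOREM.** `HardCorePoincare` (OSI crux X_C, stmt-13619, BY NAME) follows from the
single abstract input [K] `DobrushinGlauberPoincare`; the model-specific half [G] is proved above. -/
theorem hardCorePoincare_of_dobrushinGlauberPoincare (hK : DobrushinGlauberPoincare) :
    Theses.OneSphereInfluence.HardCorePoincare :=
  hardCorePoincare_of_dobrushin hK heatBathDobrushin_holds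

end Assembly

end Summit.AtomisticToContinuum.HydrodynamicLimit.Theorems.HardCorePoincareDobrushin

end
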